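import Summits.KontsevichZagierPeriods.Zeta5Search.Denom.DualSeriesBrickOrd
import Summits.KontsevichZagierPeriods.Zeta5Search.Denom.DigitCert
import Summits.KontsevichZagierPeriods.Zeta5Search.DualSeriesLemma19Record
import HarnessLib

/-!
# ζ(5) search — the record ray's brick exponent `ν` as a floor sum, and its CERTIFIED CELLS (cell `pub-zeta5`, fam-denom 64)

HONEST FRAMING: systematic search; no irrationality claim unless certified.

OUR theorem (Summit side).  On the record ray `b = bRecord n = n·(41; 17,16,15,14,13,12,11)` the brick exponent of
`Denom.DualSeriesBrickOrd` is a doubly periodic floor sum in `x = n/p`, `y = i/p`: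

    `ν(bRecord n; i, p) = N(x, y) := [⌊y⌋ − ⌊y−15x⌋ − ⌊15x⌋] + [⌊41x−y⌋ − ⌊25x−y⌋ − ⌊16x⌋]`
    `                    + Σ_{(β,β′) ∈ {(17,12),(11,17),(16,11),(12,14),(14,13),(13,15)}} [⌊(41−β−β′)x⌋ − ⌊y−βx⌋ − ⌊(41−β′)x−y⌋]`

(`nuPair_bRecord_eq`; the 24 floor terms `recTerms`, in the `coef·⌊c_y·y + c_x·x⌋` format of the cell's parametric
checker `Denom.DigitCert`), `N(x, y+1) = N(x+1, y) = N(x, y)` (`evalRec_add_int_right/left`), and the WINDOW LEMMA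
`nu_ge_of_checked_cell_shift`: for any cell `C` with `DigitCert.Cell.check recTerms C = true` and any `p > 0` with
`a₀/b₀ < n/p − m < a₁/b₁` (cross-multiplied), **`C.c ≤ ν(bRecord n; i, p)` for every `i`** — the hypothesis `hν` of
`Denom.RecordRayBrickCore.brick_core` with `ν = c`.  The certified table itself is `Denom.RecordRayNuCells`.
`p`-adic bookkeeping only; nothing here bears on irrationality.  0 sorry.
-/

namespace Summit.KontsevichZagierPeriods.Zeta5Search

namespace Denom.RecordRayNu

open Finset DigitCert DualSeriesBrickOrd DualSeriesDenominators
open DualSeriesLemma19 (bRecord)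

/-! ### The 24 floor terms of `ν` on the record ray -/

/-- The floor terms of `N(x,y)` as `coef·⌊c_y·y + c_x·x⌋`: `⌊y − a x⌋ = (1, −a)`, `⌊a x − y⌋ = (−1, a)`, `⌊a x⌋ = (0, a)`. -/
def recTerms : List Term :=
  [⟨1, 1, 0⟩, ⟨-1, 1, -15⟩, ⟨-1, 0, 15⟩,
   ⟨1, -1, 41⟩, ⟨-1, -1, 25⟩, ⟨-1, 0, 16⟩,
   ⟨1, 0, 12⟩, ⟨-1, 1, -17⟩, ⟨-1, -1, 29⟩,
   ⟨1, 0, 13⟩, ⟨-1, 1, -11⟩, ⟨-1, -1, 24⟩,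
   ⟨1, 0, 14⟩, ⟨-1, 1, -16⟩, ⟨-1, -1, 30⟩,
   ⟨1, 0, 15⟩, ⟨-1, 1, -12⟩, ⟨-1, -1, 27⟩,
   ⟨1, 0, 14⟩, ⟨-1, 1, -14⟩, ⟨-1, -1, 28⟩,
   ⟨1, 0, 13⟩, ⟨-1, 1, -13⟩, ⟨-1, -1, 26⟩]

/-- `N(x, y)`. -/
abbrev evalRec (x y : ℚ) : ℤ := evalTerms recTerms x y

/-! ### `ν(bRecord n; i, p) = N(n/p, i/p)` -/

/-- `⌊c_y·(i/p) + c_x·(n/p)⌋ = (c_y i + c_x n) / p` (integer division). (docstring added by the filing lane, P2 g5) -/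
private theorem fl_gen (n i p : ℕ) (cy cx : ℤ) :
    ⌊(cy : ℚ) * ((i : ℚ) / p) + (cx : ℚ) * ((n : ℚ) / p)⌋ = (cy * (i : ℤ) + cx * n) / (p : ℤ) := by
  rw [← Rat.floor_intCast_div_natCast]; congr 1; push_cast; ring

/-- The slots of `bRecord n` as natural numbers. -/
theorem bn_bRecord (n : ℕ) :
    bn (bRecord n) 0 = 41 * n ∧ bn (bRecord n) 1 = 17 * n ∧ bn (bRecord n) 2 = 16 * n ∧ bn (bRecord n) 3 = 15 * n ∧
    bn (bRecord n) 4 = 14 * n ∧ bn (bRecord n) 5 = 13 * n ∧ bn (bRecord n) 6 = 12 * n ∧ bn (bRecord n) 7 = 11 * n := by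
  refine ⟨?_, ?_, ?_, ?_, ?_, ?_, ?_, ?_⟩ <;> simp [bn, bRecord] <;> exact_mod_cast Int.toNat_natCast _

/-- **`ν(bRecord n; i, p) = N(n/p, i/p)`.** -/
theorem nuPair_bRecord_eq (n i p : ℕ) : nuPair (bRecord n) i p = evalRec ((n : ℚ) / p) ((i : ℚ) / p) := by
  obtain ⟨h0, h1, h2, h3, h4, h5, h6, h7⟩ := bn_bRecord n
  simp only [evalRec, evalTerms, recTerms, List.map_cons, List.map_nil, List.sum_cons, List.sum_nil, Term.eval,
    fl_gen]
  unfold nuPair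
  simp only [sum_range_succ, sum_range_zero, pfst, psnd, h0, h1, h2, h3, h4, h5, h6, h7]
  push_cast
  ring_nf

/-! ### Periodicity -/

/-- `Σ coef·c_y = 0` over `recTerms`. -/
theorem recTerms_sum_cy : (recTerms.map fun T => T.coef * T.cy).sum = 0 := by rfl

/-- `Σ coef·c_x = 0` over `recTerms`. -/
theorem recTerms_sum_cx : (recTerms.map fun T => T.coef * T.cx).sum = 0 := by rfl

/-- `N(x, y + m) = N(x, y)`. -/
theorem evalRec_add_int_right (x y : ℚ) (m : ℤ) : evalRec x (y + m) = evalRec x y := by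
  rw [evalRec, evalTerms_add_int_y, recTerms_sum_cy]; simp

/-- `N(x + m, y) = N(x, y)`. -/
theorem evalRec_add_int_left (x y : ℚ) (m : ℤ) : evalRec (x + m) y = evalRec x y := by
  rw [evalRec, evalTerms_add_int_x, recTerms_sum_cx]; simp

/-- `ν(bRecord n; i, p) = N(n/p − m, y′)` with `y′ = fract(i/p) ∈ [0,1)`. -/
theorem nuPair_bRecord_eq_fract (n i p : ℕ) (m : ℤ) :
    nuPair (bRecord n) i p = evalRec ((n : ℚ) / p - m) (Int.fract ((i : ℚ) / p)) := by
  rw [nuPair_bRecord_eq, ← Int.fract_add_floor ((i : ℚ) / p), evalRec_add_int_right, Int.fract_add_floor,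
    show (n : ℚ) / p = (n : ℚ) / p - m + (m : ℤ) by ring, evalRec_add_int_left]
  congr 1; ring

/-! ### The window lemma for a checked cell -/

/-- **Checked cell ⇒ brick exponent.**  If `Cell.check recTerms C = true` and the prime (any `p > 0`) satisfies
`a₀/b₀ < n/p − m < a₁/b₁` (cross-multiplied), then `C.c ≤ ν(bRecord n; i, p)` for EVERY `i`. -/
theorem nu_ge_of_checked_cell_shift {C : Cell} (hcheck : Cell.check recTerms C = true) {n p : ℕ} (hp : 0 < p) (m : ℕ)
    (hx0 : C.a0 * (p : ℤ) < (C.b0 : ℤ) * ((n : ℤ) - m * p)) (hx1 : (C.b1 : ℤ) * ((n : ℤ) - m * p) < C.a1 * (p : ℤ))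
    (i : ℕ) : C.c ≤ nuPair (bRecord n) i p := by
  have hb : 0 < C.b0 ∧ 0 < C.b1 := by
    have h := hcheck
    simp only [Cell.check, Bool.and_eq_true, decide_eq_true_eq] at h; exact ⟨h.1.1.1, h.1.1.2⟩
  have hp' : (0 : ℚ) < p := by exact_mod_cast hp
  have hb0 : (0 : ℚ) < C.b0 := by exact_mod_cast hb.1
  have hb1 : (0 : ℚ) < C.b1 := by exact_mod_cast hb.2
  rw [nuPair_bRecord_eq_fract n i p m]
  have hx : (n : ℚ) / p - ((m : ℕ) : ℤ) = ((((n : ℤ) - m * p : ℤ)) : ℚ) / (p : ℚ) := by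
    have hp0 : (p : ℚ) ≠ 0 := hp'.ne'
    push_cast
    field_simp
  rw [hx]
  refine Cell.check_sound hcheck ?_ ?_ (Int.fract_nonneg _) (Int.fract_lt_one _)
  · rw [div_lt_div_iff₀ hb0 hp']
    have h0 : C.a0 * (p : ℤ) < ((n : ℤ) - m * p) * (C.b0 : ℤ) := by linarith
    exact_mod_cast h0
  · rw [div_lt_div_iff₀ hp' hb1]
    have h1 : ((n : ℤ) - m * p) * (C.b1 : ℤ) < C.a1 * (p : ℤ) := by linarith
    exact_mod_cast h1

end Denom.RecordRayNu

end Summit.KontsevichZagierPeriods.Zeta5Search
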